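import Summits.BirchSwinnertonDyer.BirchSwinnertonDyer.Theorems.CyclotomicUntwistSigmaLineFamilyLevelOneDatum
import Summits.BirchSwinnertonDyer.BirchSwinnertonDyer.Theorems.CyclotomicUntwistSigmaLineFamilyTransportedConstant
import Literature.NumberTheory.EllipticCurves.CanonicalPAdicHeightAdmissibilityCriteria
import Literature.NumberTheory.EllipticCurves.PAdicLFunction
import HarnessLib

/-!
# Route `CyclotomicUntwist`, crux K1 `PSRankOneLowerHalfAtThree` (stmt-BirchSwinnertonDyer-21580):
# the σ-LINE FAMILY — the census predicate `CensusX42.IsTwistSigmaHeight` is SATISFIABLE and RIGID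
# (`∃! Dh`) for `p ≥ 3` whenever the transported constant is `p`-integral

Cell `pub/bsd-wall` (D-0145 line `route-BirchSwinnertonDyer-CyclotomicUntwist`), seat `bsd-line-cycu-p1`
g5, lane «σ-LINE FAMILY LAW — LEVEL-ONE DATUM», file 27 of the lane. THEOREMS ONLY (no definition, no
named fact, no `sorry`); helper `--supports` K1 = stmt-BirchSwinnertonDyer-21580. BSD is not proved by
this file, no crux is, and NOTHING is claimed about the census relation `CensusX42.RelationAt` itself.

WHAT. The census cell X4-2 (`Summits/BirchSwinnertonDyer/Rank1Residual/Additive/CensusX42Height.lean`)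
states its relation `RelationAtCensusHeight` for «every height datum `Dh` that IS the twist-transported
sigma height» — `CensusX42.IsTwistSigmaHeight W p V Dh :⇔ ∃ σ = t + ⋯` odd with
`SatisfiesSigmaODE σ c_E`, `c_E = transportedSigmaConst W p V`, and `Dh(P,P) = sigmaHeight W p σ P` at
EVERY `W.IsAdmissible p` point — flagging that "Bernardi quadraticity of `σ_c`-heights at an additive
prime is not a tree theorem", i.e. that the hypothesis might be vacuous. With the level-one datum
(`…LevelOneDatum`) it is not:

* `exists_isTwistSigmaHeight` — for `p ≥ 3` and `‖c_E‖_p ≤ 1`: `∃ Dh, IsTwistSigmaHeight W p V Dh`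
  (`σ = formalSigma c_E`, `Dh` = the level-one σ_{c_E}-datum);
* `isTwistSigmaHeight_unique` — for `p ≥ 3` ANY two data satisfying the predicate are EQUAL (the `σ`
  of the predicate is `formalSigma c_E` by `eq_formalSigma`; two data reading the same σ-height on the
  admissible locus agree three levels deep, `heightDatum_ext_of_deep`) — no integrality of `c_E` needed;
* `existsUnique_isTwistSigmaHeight` — `∃!`;
* `forall_isTwistSigmaHeight_iff_exists` — under `p ≥ 3`, `‖c_E‖ ≤ 1`: «`R Dh` for every datum
  satisfying the predicate» ↔ «`R Dh` for some datum satisfying it»;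
* **`existsUnique_isTwistSigmaHeight_censusScope`** — ON THE SCOPE OF `RelationAtCensusHeight`
  (`p ≥ 5`, `c₄(W)c₆(W) ≠ 0`, `V` globally minimal ordinary at `p`, `C • V^{(±p)} = W`) the integrality
  `‖c_E‖_p ≤ 1` is a THEOREM (`…TransportedConstant.norm_transportedSigmaConst_le_one`), so `∃! Dh`
  holds there UNCONDITIONALLY; **`relationAtCensusHeight_iff`** — the census conjecture is equivalent to
  the relation `RelationAt W p Dh` for THE ONE twist-sigma datum on each row of its scope (bookkeeping
  reformulation; the relation itself stays a `@[conjecture]`, nothing is asserted about it).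

References: Bernardi 1981 §1; Mazur–Stein–Tate 2006 Thm. 1.3, §2.7; Stein–Wuthrich 2013 §4.1 (4.1).
[cite: MazurSteinTate2006, §2.7] [cite: SteinWuthrich2013, §4.1 eq. (4.1)]
-/

set_option autoImplicit false
-- single-conjunct summit: `Summit.BirchSwinnertonDyer.BirchSwinnertonDyer.…` repeats the name by design
set_option linter.dupNamespace false

noncomputable section

open scoped Classical

open PowerSeries WeierstrassCurve Literature.NumberTheory.EllipticCurves
  Summit.BirchSwinnertonDyer.Rank1Residual.Additive
  Summit.BirchSwinnertonDyer.BirchSwinnertonDyer.Theorems.PSSigmaLineFamilyLevelOneDatum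
  Summit.BirchSwinnertonDyer.BirchSwinnertonDyer.Theorems.PSSigmaLineFamilyHeightDatumUnique

namespace Summit.BirchSwinnertonDyer.BirchSwinnertonDyer.Theorems.PSSigmaLineFamilyCensusHeight

variable {p : ℕ} [Fact p.Prime] (W : WeierstrassCurve ℚ) [W.IsElliptic] [W.IsGloballyMinimal]

/-- **EXISTENCE**: for `p ≥ 3` and `‖c_E‖_p ≤ 1` (`c_E = transportedSigmaConst W p V`) the census
predicate `IsTwistSigmaHeight W p V` is satisfied by the level-one datum of `σ_{c_E} = formalSigma c_E`.
[Bernardi 1981, §1; Mazur–Stein–Tate 2006, Thm. 1.3] [cite: MazurSteinTate2006, §2.7] -/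
theorem exists_isTwistSigmaHeight (hp3 : 3 ≤ p) (V : WeierstrassCurve ℚ)
    (hc : ‖CensusX42.transportedSigmaConst W p V‖ ≤ 1) :
    ∃ Dh : PAdicHeightData W p, CensusX42.IsTwistSigmaHeight W p V Dh := by
  obtain ⟨D, hD⟩ := exists_heightDatum_formalSigma_levelOne W hp3 hc
  obtain ⟨h0, h1, hodd, hODE⟩ := (W.baseChange ℚ_[p]).formalSigma_spec (CensusX42.transportedSigmaConst W p V)
  exact ⟨D, _, h0, h1, hodd, hODE, fun P hP => pairing_eq_sigmaHeight_of_isAdmissible W hD hP⟩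

omit [W.IsElliptic] [W.IsGloballyMinimal] in
/-- The `σ` of the census predicate is `formalSigma c_E` (uniqueness of the normalised odd solution),
so a datum satisfying it reads `h_{σ_{c_E}}` at every admissible point. [cite: MazurSteinTate2006, Thm. 1.3] -/
theorem pairing_eq_sigmaHeight_formalSigma_of_isTwistSigmaHeight {V : WeierstrassCurve ℚ}
    {Dh : PAdicHeightData W p} (h : CensusX42.IsTwistSigmaHeight W p V Dh) {P : W.toAffine.Point}
    (hP : W.IsAdmissible p P) :
    Dh.pairing P P = CensusX42.sigmaHeight W p
      ((W.baseChange ℚ_[p]).formalSigma (CensusX42.transportedSigmaConst W p V)) P := by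
  obtain ⟨σ, h0, h1, hodd, hODE, hD⟩ := h
  rw [← (W.baseChange ℚ_[p]).eq_formalSigma h0 h1 hodd hODE]
  exact hD P hP

/-- **RIGIDITY**: for `p ≥ 3`, two height data satisfying `IsTwistSigmaHeight W p V` are EQUAL (both read
`h_{σ_{c_E}}` at every admissible point, in particular three levels deep; `heightDatum_ext_of_deep`). No
integrality of `c_E` is needed here. [cite: MazurSteinTate2006, §2.7] -/
theorem isTwistSigmaHeight_unique (hp3 : 3 ≤ p) {V : WeierstrassCurve ℚ} {D₁ D₂ : PAdicHeightData W p}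
    (h₁ : CensusX42.IsTwistSigmaHeight W p V D₁) (h₂ : CensusX42.IsTwistSigmaHeight W p V D₂) :
    D₁ = D₂ := by
  refine heightDatum_ext_of_deep W (p := p) fun h hx _ hns => ?_
  have hadm := isAdmissible_of_one_lt_norm (W := W) hp3 h hx hns
  rw [pairing_eq_sigmaHeight_formalSigma_of_isTwistSigmaHeight W h₁ hadm,
    pairing_eq_sigmaHeight_formalSigma_of_isTwistSigmaHeight W h₂ hadm]

/-- **`∃!`**: for `p ≥ 3` and `‖c_E‖_p ≤ 1` exactly one height datum satisfies the census predicate.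
[cite: MazurSteinTate2006, §2.7] -/
theorem existsUnique_isTwistSigmaHeight (hp3 : 3 ≤ p) (V : WeierstrassCurve ℚ)
    (hc : ‖CensusX42.transportedSigmaConst W p V‖ ≤ 1) :
    ∃! Dh : PAdicHeightData W p, CensusX42.IsTwistSigmaHeight W p V Dh := by
  obtain ⟨D, hD⟩ := exists_isTwistSigmaHeight W hp3 V hc
  exact ⟨D, hD, fun D' hD' => isTwistSigmaHeight_unique W hp3 hD' hD⟩

/-- Bookkeeping: under `p ≥ 3` and `‖c_E‖ ≤ 1`, «`RelationAt` for every datum satisfying the predicate»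
is «`RelationAt` for some datum satisfying the predicate» (there is exactly one). Nothing is asserted
about `RelationAt`. [cite: MazurSteinTate2006, §2.7] -/
theorem forall_isTwistSigmaHeight_iff_exists (hp3 : 3 ≤ p) (V : WeierstrassCurve ℚ)
    (hc : ‖CensusX42.transportedSigmaConst W p V‖ ≤ 1) (R : PAdicHeightData W p → Prop) :
    (∀ Dh, CensusX42.IsTwistSigmaHeight W p V Dh → R Dh) ↔
      ∃ Dh, CensusX42.IsTwistSigmaHeight W p V Dh ∧ R Dh := by
  obtain ⟨D, hD⟩ := exists_isTwistSigmaHeight W hp3 V hc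
  constructor
  · exact fun h => ⟨D, hD, h D hD⟩
  · rintro ⟨D', hD', hR⟩ Dh hDh
    rw [isTwistSigmaHeight_unique W hp3 hDh hD', ← isTwistSigmaHeight_unique W hp3 hD' hD'] 
    exact hR

/-! ### On the scope of `RelationAtCensusHeight`: unconditional `∃!` -/

/-- **`∃!` ON THE CENSUS SCOPE, UNCONDITIONALLY**: for `p ≥ 5`, `W/ℚ` globally minimal with
`c₄(W) ≠ 0`, `c₆(W) ≠ 0`, `V/ℚ` globally minimal and ordinary (in particular good) at `p`, and
`C • V^{(p)} = W` or `C • V^{(−p)} = W`, exactly one height datum satisfies `IsTwistSigmaHeight W p V`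
(`‖c_E‖_p ≤ 1` by `norm_transportedSigmaConst_le_one`). [cite: MazurSteinTate2006, Thm. 1.3 and §2.7] -/
theorem existsUnique_isTwistSigmaHeight_censusScope (hp5 : 5 ≤ p) (h4 : W.c₄ ≠ 0) (h6 : W.c₆ ≠ 0)
    (V : WeierstrassCurve ℚ) [V.IsElliptic] [V.IsGloballyMinimal] (hord : IsOrdinaryAt V p)
    (C : VariableChange ℚ)
    (hC : C • V.quadraticTwist (p : ℚ) = W ∨ C • V.quadraticTwist (-(p : ℚ)) = W) :
    ∃! Dh : PAdicHeightData W p, CensusX42.IsTwistSigmaHeight W p V Dh :=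
  existsUnique_isTwistSigmaHeight W (by omega) V
    (PSSigmaLineFamilyTransportedConstant.norm_transportedSigmaConst_le_one hp5 W h4 h6 V hord.1 C hC)

/-- **The census conjecture, datum-free**: `RelationAtCensusHeight W p` holds iff on every row of its
scope the relation `RelationAt W p Dh` holds for SOME (equivalently THE, equivalently EVERY) datum `Dh`
with `IsTwistSigmaHeight W p V Dh` — the `∀ Dh` of the census text quantifies over a singleton.
Bookkeeping only: `RelationAt` stays conjectural and nothing is asserted about it.
[cite: MazurSteinTate2006, Thm. 1.3 and §2.7] -/
theorem relationAtCensusHeight_iff :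
    CensusX42.RelationAtCensusHeight W p ↔
      (5 ≤ p → W.c₄ ≠ 0 → W.c₆ ≠ 0 →
        ∀ (V : WeierstrassCurve ℚ) [V.IsElliptic] [V.IsGloballyMinimal] (C : VariableChange ℚ),
          IsOrdinaryAt V p →
          (C • V.quadraticTwist (p : ℚ) = W ∨ C • V.quadraticTwist (-(p : ℚ)) = W) →
          ∃ Dh : PAdicHeightData W p, CensusX42.IsTwistSigmaHeight W p V Dh ∧ CensusX42.RelationAt W p Dh) := by
  unfold CensusX42.RelationAtCensusHeight
  refine forall₃_congr fun hp5 h4 h6 => forall_congr' fun V => forall_congr' fun _ =>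
    forall_congr' fun _ => forall_congr' fun C => forall₂_congr fun hord hC => ?_
  exact forall_isTwistSigmaHeight_iff_exists W (by omega) V
    (PSSigmaLineFamilyTransportedConstant.norm_transportedSigmaConst_le_one hp5 W h4 h6 V hord.1 C hC) _

end Summit.BirchSwinnertonDyer.BirchSwinnertonDyer.Theorems.PSSigmaLineFamilyCensusHeight

end
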